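import Literature.NumberTheory.QuadraticFields.ZsqrtdFormClassGroup
import Literature.NumberTheory.QuadraticFields.BinaryQuadraticFormsRepresentation
import HarnessLib

/-!
# The form class group of discriminant `4d` is the ideal class group of `ℤ[√d]`:
# proof of Cox, Thm. 7.7 (i)–(ii) for the order `ℤ[√d]` (`cox_formClassGroup_holds`)

Topic `NumberTheory/QuadraticFields`; a proofs-only sibling (theorems only, no definitions, no
named facts) of `Literature/NumberTheory/QuadraticFields/ZsqrtdFormClassGroup.lean`, whose named
fact `cox_formClassGroup` — **Cox, *Primes of the form x² + ny²*, Thm. 7.7 (i)–(ii) with Thm. 2.8**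
for the order `𝒪 = ℤ[√d]` of discriminant `D = 4d < 0` — is discharged here
(`cox_formClassGroup_holds`): for `d < 0` (and `ℤ√d` a domain),

1. the ideal `𝔞_f = [a, (-b + √D)/2] = (a, -b/2 + √d)` (`ideal d f`) of a primitive positive
   definite form `f = (a, b, c)` of discriminant `4d` is invertible (`IsUnit (fracIdeal d f)`);
2. properly equivalent forms have the same class `toClass d f ∈ ClassGroup (ℤ√d)`;
3. `f ↦ toClass d f` is a bijection from the reduced primitive positive definite forms of
   discriminant `4d` ("labels", `IsLabel d`) onto `ClassGroup (ℤ√d)`.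

**Proof** (Cox, §7.A–§7.B, PDF pp. 149–152 of the held copy; we follow the printed architecture,
replacing the two complex-analytic steps — the root `τ ∈ 𝔥` of a form and (7.10)
`Im(γτ) = det γ |rτ + s|⁻² Im τ` — by their algebraic content in `ℤ[√d] = ℤ ⊕ ℤ√d`).  Write
`f = (a, 2β, c)` (the middle coefficient of a form of discriminant `4d` is even), `β² - ac = d`,
`ω = -β + √d`, so `𝔞_f = (a, ω)`; the basic tool is the *membership criterion*
`z ∈ 𝔞_f ↔ a ∣ Re z + β Im z` (`mem_span_pair_iff`), i.e. `𝔞_f = ℤa ⊕ ℤω` is Cox's lattice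
`[a, aτ] = a[1, τ]`.

* (i) — Cox (7.6) `𝔞 𝔞̄ = (N(α)/a)𝒪` specialised: `(a, -β + √d)(a, β + √d) = (a)`, the four
  products of generators being `a², a(±β + √d), -ac` and `gcd(a, 2β, c) = 1`
  (`span_pair_mul_span_pair_neg`); hence `𝔞_f` is invertible (`isUnit_fracIdeal_of_isPosPrim`).
* (ii), well-defined — Cox (7.8) `⟹`, `[1, τ] = λ[1, τ']` with `λ = rτ' + s`: for
  `γ = (p q; r s) ∈ SL₂(ℤ)`, `(μ)·𝔞_f = (a)·𝔞_{f·γ}` with `μ = ap + r(β + √d)`, checked on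
  coordinates (`span_mul_span_pair_act`, `span_mul_ideal_act`); classes are then equal by
  Mathlib's `ClassGroup.mk_eq_mk_of_coe_ideal` (`toClass_eq_of_properEquiv`).
* injectivity — Cox (7.8) `⟸`: if `(x)·𝔞_f = (y)·𝔞_g`, `x, y ≠ 0`, write `y a' = x w₁`,
  `y ω' = x w₂` with `wᵢ = kᵢ a + lᵢ ω` and symmetrically; the orientation form
  `det(e₁, e₂) = Re e₁ Im e₂ - Im e₁ Re e₂` scales by `N(x) > 0` under multiplication by `x`
  (`det_mul_left`, the substitute for (7.10)), giving `N(y)a' = N(x)a(k₁l₂ - l₁k₂)` and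
  `N(x)a = N(y)a'(k₃l₄ - l₃k₄)`, so `k₁l₂ - l₁k₂ = 1`; then `g = f·(k₁ -k₂; -l₁ l₂)` by comparing
  `det`, `Re(e₁ē₂)` and norms (`coeffs_eq_of_rel`, Cox's Exercise 7.12 "a form is determined by
  its root"), and two properly equivalent reduced forms are equal (Thm. 2.8, uniqueness — the
  tree's `eq_of_properEquiv_of_isReduced`).
* surjectivity — a class is represented by an invertible integral ideal `J` (clearing
  denominators, `FractionalIdeal.exists_eq_spanSingleton_mul`); `J = k·(n, m + √d)` with
  `n ∣ m² - d` (Hermite normal form of a rank-2 lattice, Cox Exercise 7.8: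
  `exists_eq_span_mul_span`); `(n, m + √d) = 𝔞_f` for `f = (n, -2m, (m² - d)/n)`, which is
  primitive because an invertible ideal has no multipliers outside `ℤ[√d]` (Prop. 7.4 `⟹`)
  while `(m + √d)/gcd(n, 2m, c)` is a multiplier (Lemma 7.5's computation)
  (`isPrimitive_of_isUnit`); finally `f` reduces to a label (Thm. 2.8, existence — the tree's
  `exists_properEquiv_isReduced`) in the same class by (ii).

Mathlib (pin v4.32.0) supplies `Zsqrtd` (components `re`, `im`, `norm`), `ClassGroup`,
`FractionalIdeal` (`spanSingleton`, `coeIdeal_mul`, `exists_eq_spanSingleton_mul`),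
`ClassGroup.mk_eq_mk_of_coe_ideal`, `ClassGroup.induction`,
`Ideal.span_singleton_mul_eq_span_singleton_mul`, `Submodule.IsPrincipal.generator`; it has no
form/ideal dictionary for quadratic orders (searched `Zsqrtd` + `ClassGroup`, `binary quadratic`).
From the tree: `BinQF`, `act`, `disc_act`, `ProperEquiv`, `IsPosPrim`, `even_b`, `ideal`,
`fracIdeal`, `toClass`, `toClass_of_isUnit`, `IsLabel`, `exists_properEquiv_isReduced`,
`eq_of_properEquiv_of_isReduced`; nothing is restated.

## References

* [Cox2013] D. A. Cox, *Primes of the form x² + ny²*, 2nd ed., Wiley 2013: §7.A Prop. 7.4,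
  Lemma 7.5, (7.6), Exercise 7.8 (PDF pp. 149–150 of the held copy); §7.B **Thm. 7.7** and its
  proof, (7.8)–(7.11), Exercises 7.11–7.12 (PDF pp. 150–152); §2.A Thm. 2.8.
-/

noncomputable section

open scoped nonZeroDivisors Classical

namespace Literature.NumberTheory.QuadraticFields.Quadratic.BinQF

variable {d : ℤ}

/-! ### The lattice `(a, -β + √d) = ℤa ⊕ ℤ(-β + √d)` -/

/-- **Membership criterion** (`[a, -β + √d]` is the free `ℤ`-module on `a, -β + √d`, Cox's
`[a, aτ] = a[1, τ]`): for `β² - ac = d`, `z ∈ (a, -β + √d) ↔ a ∣ Re z + β Im z`. [folklore] -/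
theorem mem_span_pair_iff {a β c : ℤ} (hd : β ^ 2 - a * c = d) (z : ℤ√d) :
    z ∈ Ideal.span {(a : ℤ√d), ⟨-β, 1⟩} ↔ a ∣ z.re + β * z.im := by
  constructor
  · intro hz
    obtain ⟨u, v, rfl⟩ := Ideal.mem_span_pair.1 hz
    refine ⟨u.re + β * u.im - c * v.im, ?_⟩
    simp only [Zsqrtd.re_add, Zsqrtd.im_add, Zsqrtd.re_mul, Zsqrtd.im_mul, Zsqrtd.re_intCast,
      Zsqrtd.im_intCast]
    linear_combination (-v.im) * hd
  · rintro ⟨k, hk⟩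
    refine Ideal.mem_span_pair.2 ⟨(k : ℤ√d), (z.im : ℤ√d), ?_⟩
    ext
    · simp only [Zsqrtd.re_add, Zsqrtd.re_mul, Zsqrtd.re_intCast, Zsqrtd.im_intCast]
      linear_combination (-1 : ℤ) * hk
    · simp only [Zsqrtd.im_add, Zsqrtd.im_mul, Zsqrtd.re_intCast, Zsqrtd.im_intCast]
      ring

/-- `a ∈ (a, -β + √d)`. [folklore] -/
theorem intCast_mem_span_pair (a β : ℤ) : (a : ℤ√d) ∈ Ideal.span {(a : ℤ√d), ⟨-β, 1⟩} :=
  Ideal.subset_span (by simp)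

/-- `-β + √d ∈ (a, -β + √d)`. [folklore] -/
theorem omega_mem_span_pair (a β : ℤ) : (⟨-β, 1⟩ : ℤ√d) ∈ Ideal.span {(a : ℤ√d), ⟨-β, 1⟩} :=
  Ideal.subset_span (by simp)

/-- **Cox (7.6), specialised**: `(a, -β + √d) · (a, β + √d) = (a)` when `gcd(a, 2β, c) = 1`,
`β² - ac = d` (the products of generators are `a², a(β + √d), a(-β + √d), -ac`, and
`a = a(xa + y·2β + zc)`). [cite: Cox2013, §7.A (7.6)] -/
theorem span_pair_mul_span_pair_neg {a β c : ℤ} (hd : β ^ 2 - a * c = d)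
    (hprim : ∃ x y z : ℤ, x * a + y * (2 * β) + z * c = 1) :
    Ideal.span {(a : ℤ√d), ⟨-β, 1⟩} * Ideal.span {(a : ℤ√d), ⟨-(-β), 1⟩} =
      Ideal.span {(a : ℤ√d)} := by
  apply le_antisymm
  · refine Ideal.mul_le.2 fun r hr s hs => ?_
    rw [mem_span_pair_iff hd] at hr
    rw [mem_span_pair_iff (c := c) (by rw [← hd]; ring)] at hs
    obtain ⟨k, hk⟩ := hr
    obtain ⟨l, hl⟩ := hs
    have hr' : r.re = a * k - β * r.im := by linear_combination hk
    have hs' : s.re = a * l + β * s.im := by linear_combination hl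
    rw [Ideal.mem_span_singleton, Zsqrtd.intCast_dvd]
    refine ⟨⟨a * k * l + k * β * s.im - β * l * r.im - c * r.im * s.im, ?_⟩,
      ⟨k * s.im + l * r.im, ?_⟩⟩
    · rw [Zsqrtd.re_mul, hr', hs']
      linear_combination (r.im * s.im) * hd.symm
    · rw [Zsqrtd.im_mul, hr', hs']
      ring
  · rw [Ideal.span_singleton_le_iff_mem]
    obtain ⟨x, y, z, hxyz⟩ := hprim
    have h1 : (a : ℤ√d) * a ∈ Ideal.span {(a : ℤ√d), ⟨-β, 1⟩} * Ideal.span {(a : ℤ√d), ⟨-(-β), 1⟩} :=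
      Ideal.mul_mem_mul (intCast_mem_span_pair a β) (intCast_mem_span_pair a (-β))
    have h2 : (a : ℤ√d) * ⟨-(-β), 1⟩ ∈
        Ideal.span {(a : ℤ√d), ⟨-β, 1⟩} * Ideal.span {(a : ℤ√d), ⟨-(-β), 1⟩} :=
      Ideal.mul_mem_mul (intCast_mem_span_pair a β) (omega_mem_span_pair a (-β))
    have h3 : (⟨-β, 1⟩ : ℤ√d) * a ∈
        Ideal.span {(a : ℤ√d), ⟨-β, 1⟩} * Ideal.span {(a : ℤ√d), ⟨-(-β), 1⟩} :=
      Ideal.mul_mem_mul (omega_mem_span_pair a β) (intCast_mem_span_pair a (-β))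
    have h4 : (⟨-β, 1⟩ : ℤ√d) * ⟨-(-β), 1⟩ ∈
        Ideal.span {(a : ℤ√d), ⟨-β, 1⟩} * Ideal.span {(a : ℤ√d), ⟨-(-β), 1⟩} :=
      Ideal.mul_mem_mul (omega_mem_span_pair a β) (omega_mem_span_pair a (-β))
    have key : (a : ℤ√d) = (x : ℤ√d) * ((a : ℤ√d) * a) +
        (y : ℤ√d) * ((a : ℤ√d) * ⟨-(-β), 1⟩ - ⟨-β, 1⟩ * a) +
        (-z : ℤ√d) * ((⟨-β, 1⟩ : ℤ√d) * ⟨-(-β), 1⟩) := by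
      ext
      · simp only [Zsqrtd.re_add, Zsqrtd.re_sub, Zsqrtd.re_mul, Zsqrtd.im_sub, Zsqrtd.im_mul,
          Zsqrtd.re_intCast, Zsqrtd.im_intCast, Zsqrtd.re_neg, Zsqrtd.im_neg]
        linear_combination (-a) * hxyz + (-z) * hd
      · simp only [Zsqrtd.re_sub, Zsqrtd.re_mul, Zsqrtd.im_add, Zsqrtd.im_sub, Zsqrtd.im_mul,
          Zsqrtd.re_intCast, Zsqrtd.im_intCast, Zsqrtd.re_neg, Zsqrtd.im_neg]
        ring
    have hmem : (x : ℤ√d) * ((a : ℤ√d) * a) +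
        (y : ℤ√d) * ((a : ℤ√d) * ⟨-(-β), 1⟩ - ⟨-β, 1⟩ * a) +
        (-z : ℤ√d) * ((⟨-β, 1⟩ : ℤ√d) * ⟨-(-β), 1⟩) ∈
        Ideal.span {(a : ℤ√d), ⟨-β, 1⟩} * Ideal.span {(a : ℤ√d), ⟨-(-β), 1⟩} :=
      Submodule.add_mem _ (Submodule.add_mem _ (Ideal.mul_mem_left _ _ h1)
        (Ideal.mul_mem_left _ _ (Submodule.sub_mem _ h2 h3))) (Ideal.mul_mem_left _ _ h4)
    rwa [← key] at hmem

/-- **Cox (7.8), `⟹`, in coordinates**: for `γ = (p q; r s) ∈ SL₂(ℤ)` and the transformed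
coefficients `a' = ap² + 2βpr + cr²`, `β' = apq + β(ps + qr) + crs` of `(a, 2β, c)·γ`, one has
`(μ) · (a, -β + √d) = (a) · (a', -β' + √d)` with `μ = ap + r(β + √d)` (Cox: `[1, τ] = λ[1, τ']`,
`λ = rτ' + s`; here `u = μ`, `v = μω/a` satisfy `a' = pu - rv`, `ω' = -qu + sv`).
[cite: Cox2013, §7.B (7.8)–(7.9)] -/
theorem span_mul_span_pair_act {a β c : ℤ} (hd : β ^ 2 - a * c = d) {p q r s : ℤ}
    (hdet : p * s - q * r = 1) :
    Ideal.span {(⟨a * p + β * r, r⟩ : ℤ√d)} * Ideal.span {(a : ℤ√d), ⟨-β, 1⟩} =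
      Ideal.span {(a : ℤ√d)} *
        Ideal.span {((a * p ^ 2 + 2 * β * p * r + c * r ^ 2 : ℤ) : ℤ√d),
          ⟨-(a * p * q + β * (p * s + q * r) + c * r * s), 1⟩} := by
  have hd' : (a * p * q + β * (p * s + q * r) + c * r * s) ^ 2 -
      (a * p ^ 2 + 2 * β * p * r + c * r ^ 2) * (a * q ^ 2 + 2 * β * q * s + c * s ^ 2) = d := by
    rw [← hd]
    linear_combination (β ^ 2 - a * c) * (p * s - q * r + 1) * hdet
  rw [Ideal.span_singleton_mul_eq_span_singleton_mul]
  constructor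
  · intro zI hzI
    obtain ⟨k, hk⟩ := (mem_span_pair_iff hd zI).1 hzI
    refine ⟨⟨k * (a * p + β * r) + zI.im * (-β * p - c * r), k * r + zI.im * p⟩,
      (mem_span_pair_iff hd' _).2 ⟨k * s + zI.im * q, ?_⟩, ?_⟩
    · dsimp only
      linear_combination (-k * (a * p + β * r) + zI.im * (β * p + c * r)) * hdet
    · ext
      · simp only [Zsqrtd.re_mul, Zsqrtd.re_intCast, Zsqrtd.im_intCast]
        linear_combination (a * p + β * r) * hk + (-r * zI.im) * hd
      · simp only [Zsqrtd.im_mul, Zsqrtd.re_intCast, Zsqrtd.im_intCast]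
        linear_combination r * hk
  · intro zJ hzJ
    obtain ⟨k, hk⟩ := (mem_span_pair_iff hd' zJ).1 hzJ
    refine ⟨⟨(k * p - zJ.im * q) * a - (zJ.im * s - k * r) * β, zJ.im * s - k * r⟩,
      (mem_span_pair_iff hd _).2 ⟨k * p - zJ.im * q, by dsimp only; ring⟩, ?_⟩
    ext
    · simp only [Zsqrtd.re_mul, Zsqrtd.re_intCast, Zsqrtd.im_intCast]
      linear_combination (-a) * hk + (-r * (zJ.im * s - k * r)) * hd
    · simp only [Zsqrtd.im_mul, Zsqrtd.re_intCast, Zsqrtd.im_intCast]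
      linear_combination (a * zJ.im) * hdet

/-! ### Orientation and the recovery of a form from its ideal -/

/-- `N(u + v√d) = u² - d v²`. [folklore] -/
theorem norm_mk (u v : ℤ) : (⟨u, v⟩ : ℤ√d).norm = u * u - d * v * v := rfl

/-- Multiplication by `x` scales the orientation form `det(e₁, e₂) = Re e₁ Im e₂ - Im e₁ Re e₂`
(in the basis `1, √d`) by `N(x)` — the algebraic content of Cox (7.10),
`Im(γτ) = det γ · |rτ + s|⁻² · Im τ`. [cite: Cox2013, §7.B (7.10)] -/
theorem det_mul_left (x e₁ e₂ : ℤ√d) :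
    (x * e₁).re * (x * e₂).im - (x * e₁).im * (x * e₂).re =
      x.norm * (e₁.re * e₂.im - e₁.im * e₂.re) := by
  simp only [Zsqrtd.re_mul, Zsqrtd.im_mul, Zsqrtd.norm_def]
  ring

/-- Multiplication by `x` scales the symmetric form `Re(e₁ē₂) = Re e₁ Re e₂ - d Im e₁ Im e₂` by
`N(x)`. [folklore] -/
theorem redot_mul_left (x e₁ e₂ : ℤ√d) :
    (x * e₁).re * (x * e₂).re - d * (x * e₁).im * (x * e₂).im =
      x.norm * (e₁.re * e₂.re - d * e₁.im * e₂.im) := by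
  simp only [Zsqrtd.re_mul, Zsqrtd.im_mul, Zsqrtd.norm_def]
  ring

/-- **Cox (7.8) `⟸`, recovering the form** (Exercise 7.12: a form is determined by its root):
if `x(pa - rω) = y a'` and `x(-qa + sω) = y ω'` with `ω = -β + √d`, `ω' = -β' + √d`,
`ps - qr = 1` and `N(x) a ≠ 0`, then `a'` and `β'` are the coefficients of `(a, 2β, c)·(p q; r s)`
— compare `det`, `Re(· ·̄)` and the norm of both sides. [cite: Cox2013, §7.B (7.8), Exercise 7.12] -/
theorem coeffs_eq_of_rel {a β c a' β' : ℤ} (hd : β ^ 2 - a * c = d) {p q r s : ℤ}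
    (hdet : p * s - q * r = 1) {x y : ℤ√d} (hNa : x.norm * a ≠ 0)
    (h₁ : x * ⟨a * p + β * r, -r⟩ = y * a') (h₂ : x * ⟨-a * q - β * s, s⟩ = y * ⟨-β', 1⟩) :
    a' = a * p ^ 2 + 2 * β * p * r + c * r ^ 2 ∧
      β' = a * p * q + β * (p * s + q * r) + c * r * s := by
  have hc := det_mul_left x ⟨a * p + β * r, -r⟩ ⟨-a * q - β * s, s⟩
  rw [h₁, h₂, det_mul_left] at hc
  have hr := redot_mul_left x ⟨a * p + β * r, -r⟩ ⟨-a * q - β * s, s⟩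
  rw [h₁, h₂, redot_mul_left] at hr
  have hn := congrArg Zsqrtd.norm h₁
  rw [Zsqrtd.norm_mul, Zsqrtd.norm_mul, Zsqrtd.norm_intCast, norm_mk (a * p + β * r) (-r)] at hn
  simp only [Zsqrtd.re_intCast, Zsqrtd.im_intCast] at hc hr
  have E : y.norm * a' = x.norm * a := by
    linear_combination hc + (x.norm * a) * hdet
  constructor
  · apply mul_left_cancel₀ hNa
    linear_combination (-1 : ℤ) * hn + (-a') * E + (x.norm * r ^ 2) * hd
  · apply mul_left_cancel₀ hNa
    linear_combination (-1 : ℤ) * hr + (-β') * E + (x.norm * r * s) * hd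

/-! ### Forms of discriminant `4d` and their ideals -/

/-- `gcd(a, b, c) = 1` in Bézout form. [folklore] -/
theorem exists_combination_of_isPrimitive {f : BinQF} (h : f.IsPrimitive) :
    ∃ x y z : ℤ, x * f.a + y * f.b + z * f.c = 1 := by
  have h1 : Int.gcd (Int.gcd f.a f.b : ℤ) f.c = 1 := by
    rw [Int.gcd_def, Int.natAbs_natCast]
    exact h
  have h2 := Int.gcd_eq_gcd_ab (Int.gcd f.a f.b : ℤ) f.c
  have h3 := Int.gcd_eq_gcd_ab f.a f.b
  rw [h1, Nat.cast_one] at h2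
  exact ⟨Int.gcdA f.a f.b * Int.gcdA (Int.gcd f.a f.b : ℤ) f.c,
    Int.gcdB f.a f.b * Int.gcdA (Int.gcd f.a f.b : ℤ) f.c, Int.gcdB (Int.gcd f.a f.b : ℤ) f.c,
    by linear_combination (-1 : ℤ) * h2 + (-Int.gcdA (Int.gcd f.a f.b : ℤ) f.c) * h3⟩

/-- Half the middle coefficient: a form of discriminant `4d` is `(a, 2β, c)` with `β² - ac = d`.
[folklore] -/
theorem exists_b_eq_two_mul {f : BinQF} (h : f.disc = 4 * d) :
    ∃ β : ℤ, f.b = 2 * β ∧ β ^ 2 - f.a * f.c = d := by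
  obtain ⟨β, hb⟩ := even_b d h
  refine ⟨β, by rw [hb]; ring, ?_⟩
  have h4 : 4 * (β ^ 2 - f.a * f.c) = 4 * d := by rw [← h, disc, hb]; ring
  linarith

/-- With `b = 2β`, `ideal d f = (a, -β + √d)`. [folklore] -/
theorem ideal_eq_span_pair {f : BinQF} {β : ℤ} (hb : f.b = 2 * β) :
    ideal d f = Ideal.span {(f.a : ℤ√d), ⟨-β, 1⟩} := by
  rw [ideal, hb, Int.mul_ediv_cancel_left _ two_ne_zero]

/-- The coefficients of `f·γ` for `f = (a, 2β, c)`: `a' = ap² + 2βpr + cr²`,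
`b' = 2(apq + β(ps + qr) + crs)`. [cite: Cox2013, §2.A] -/
theorem act_eq_of_b_eq {f : BinQF} {β : ℤ} (hb : f.b = 2 * β) (p q r s : ℤ) :
    (f.act p q r s).a = f.a * p ^ 2 + 2 * β * p * r + f.c * r ^ 2 ∧
      (f.act p q r s).b = 2 * (f.a * p * q + β * (p * s + q * r) + f.c * r * s) := by
  refine ⟨?_, ?_⟩
  · show f.a * p ^ 2 + f.b * p * r + f.c * r ^ 2 = _
    linear_combination (p * r) * hb
  · show 2 * f.a * p * q + f.b * (p * s + q * r) + 2 * f.c * r * s = _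
    linear_combination (p * s + q * r) * hb

/-- **Cox (7.8) `⟹` for forms**: `(μ) · 𝔞_f = (a) · 𝔞_{f·γ}` for `γ ∈ SL₂(ℤ)`,
`μ = ap + r(β + √d)`. [cite: Cox2013, §7.B (7.8)] -/
theorem span_mul_ideal_act {f : BinQF} {β : ℤ} (hb : f.b = 2 * β) (hd : β ^ 2 - f.a * f.c = d)
    {p q r s : ℤ} (hdet : p * s - q * r = 1) :
    Ideal.span {(⟨f.a * p + β * r, r⟩ : ℤ√d)} * ideal d f =
      Ideal.span {(f.a : ℤ√d)} * ideal d (f.act p q r s) := by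
  obtain ⟨ha', hb'⟩ := act_eq_of_b_eq hb p q r s
  rw [ideal_eq_span_pair hb, ideal_eq_span_pair hb', ha']
  exact span_mul_span_pair_act hd hdet

/-- Two forms with the same discriminant, the same `a ≠ 0` and the same `b` are equal.
[folklore] -/
theorem ext_of_disc {g g' : BinQF} (ha : g.a = g'.a) (hb : g.b = g'.b) (hdisc : g.disc = g'.disc)
    (ha0 : g.a ≠ 0) : g = g' := by
  ext
  · exact ha
  · exact hb
  · simp only [disc] at hdisc
    rw [ha, hb] at hdisc
    have h4 : (4 * g'.a) * g.c = (4 * g'.a) * g'.c := by linear_combination (-1 : ℤ) * hdisc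
    exact mul_left_cancel₀ (by rw [← ha]; omega) h4

/-- **Cox, (7.8) `⟸` for `ℤ[√d]`**: if `(x)·𝔞_f = (y)·𝔞_g` with `x, y ≠ 0` then `f` and `g` are
properly equivalent.  Writing `y a' = x w₁`, `y ω' = x w₂` with `w₁ = k₁a + l₁ω`, `w₂ = k₂a + l₂ω`
(and symmetrically), the orientation form gives `N(y)a' = N(x) a (k₁l₂ - l₁k₂)` and
`N(x)a = N(y) a' (k₃l₄ - l₃k₄)`, whence `k₁l₂ - l₁k₂ = 1` (Cox uses (7.10): both roots lie in
`𝔥`); then `g = f·(k₁ -k₂; -l₁ l₂)` by `coeffs_eq_of_rel`. [cite: Cox2013, §7.B Thm. 7.7(ii), (7.8)] -/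
theorem properEquiv_of_span_mul_ideal_eq (hd0 : d < 0) {f g : BinQF} (hf : f.IsPosPrim (4 * d))
    (hg : g.IsPosPrim (4 * d)) {x y : ℤ√d} (hx : x ≠ 0) (hy : y ≠ 0)
    (h : Ideal.span {x} * ideal d f = Ideal.span {y} * ideal d g) : f.ProperEquiv g := by
  obtain ⟨β, hb, hdf⟩ := exists_b_eq_two_mul hf.disc_eq
  obtain ⟨β', hb', hdg⟩ := exists_b_eq_two_mul hg.disc_eq
  rw [ideal_eq_span_pair hb, ideal_eq_span_pair hb',
    Ideal.span_singleton_mul_eq_span_singleton_mul] at h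
  obtain ⟨hA, hB⟩ := h
  obtain ⟨w₁, hw₁, e₁⟩ := hB _ (intCast_mem_span_pair g.a β')
  obtain ⟨w₂, hw₂, e₂⟩ := hB _ (omega_mem_span_pair g.a β')
  obtain ⟨w₃, hw₃, e₃⟩ := hA _ (intCast_mem_span_pair f.a β)
  obtain ⟨w₄, hw₄, e₄⟩ := hA _ (omega_mem_span_pair f.a β)
  obtain ⟨k₁, hk₁⟩ := (mem_span_pair_iff hdf w₁).1 hw₁
  obtain ⟨k₂, hk₂⟩ := (mem_span_pair_iff hdf w₂).1 hw₂
  obtain ⟨k₃, hk₃⟩ := (mem_span_pair_iff hdg w₃).1 hw₃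
  obtain ⟨k₄, hk₄⟩ := (mem_span_pair_iff hdg w₄).1 hw₄
  have hNx : 0 < x.norm := lt_of_le_of_ne (Zsqrtd.norm_nonneg hd0.le x)
    (fun h0 => hx ((Zsqrtd.norm_eq_zero_iff hd0 x).1 h0.symm))
  have hNy : 0 < y.norm := lt_of_le_of_ne (Zsqrtd.norm_nonneg hd0.le y)
    (fun h0 => hy ((Zsqrtd.norm_eq_zero_iff hd0 y).1 h0.symm))
  have ha := hf.a_pos
  have ha' := hg.a_pos
  -- orientation: the two transition determinants are positive and mutually inverse
  have c1 := det_mul_left x w₁ w₂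
  rw [e₁, e₂, det_mul_left] at c1
  have c2 := det_mul_left y w₃ w₄
  rw [← e₃, ← e₄, det_mul_left] at c2
  simp only [Zsqrtd.re_intCast, Zsqrtd.im_intCast] at c1 c2
  have E1 : y.norm * g.a = x.norm * f.a * (k₁ * w₂.im - w₁.im * k₂) := by
    have hr1 : w₁.re = f.a * k₁ - β * w₁.im := by linear_combination hk₁
    have hr2 : w₂.re = f.a * k₂ - β * w₂.im := by linear_combination hk₂
    rw [hr1, hr2] at c1
    linear_combination c1
  have E2 : x.norm * f.a = y.norm * g.a * (k₃ * w₄.im - w₃.im * k₄) := by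
    have hr3 : w₃.re = g.a * k₃ - β' * w₃.im := by linear_combination hk₃
    have hr4 : w₄.re = g.a * k₄ - β' * w₄.im := by linear_combination hk₄
    rw [hr3, hr4] at c2
    linear_combination c2
  have hpos : 0 < k₁ * w₂.im - w₁.im * k₂ := by
    by_contra hle
    push Not at hle
    nlinarith [mul_pos hNy ha', mul_pos hNx ha]
  have hDD : (k₃ * w₄.im - w₃.im * k₄) * (k₁ * w₂.im - w₁.im * k₂) = 1 := by
    have h0 : y.norm * g.a *
        ((k₃ * w₄.im - w₃.im * k₄) * (k₁ * w₂.im - w₁.im * k₂) - 1) = 0 := by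
      linear_combination (-1 : ℤ) * E1 + (-(k₁ * w₂.im - w₁.im * k₂)) * E2
    rcases mul_eq_zero.1 h0 with h0 | h0
    · exact absurd h0 (mul_pos hNy ha').ne'
    · linear_combination h0
  have hD1 : k₁ * w₂.im - w₁.im * k₂ = 1 := Int.eq_one_of_mul_eq_one_left hpos.le hDD
  -- the matrix `γ = (k₁ -k₂; -l₁ l₂)` and `g = f·γ`
  refine ⟨k₁, -k₂, -w₁.im, w₂.im, by linear_combination hD1, ?_⟩
  have hw₁' : w₁ = ⟨f.a * k₁ + β * -w₁.im, -(-w₁.im)⟩ := by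
    ext
    · simp only
      linear_combination hk₁
    · simp
  have hw₂' : w₂ = ⟨-f.a * -k₂ - β * w₂.im, w₂.im⟩ := by
    ext
    · simp only
      linear_combination hk₂
    · simp
  rw [hw₁'] at e₁
  rw [hw₂'] at e₂
  obtain ⟨h₁, h₂⟩ := coeffs_eq_of_rel hdf (by linear_combination hD1) (mul_pos hNx ha).ne' e₁ e₂
  obtain ⟨ha'', hb''⟩ := act_eq_of_b_eq hb k₁ (-k₂) (-w₁.im) w₂.im
  refine ext_of_disc (by rw [ha'', h₁]) (by rw [hb'', hb', h₂]) ?_ ha'.ne'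
  rw [hg.disc_eq, disc_act, hf.disc_eq]
  linear_combination (-4 * d * (k₁ * w₂.im - -k₂ * -w₁.im + 1)) * hD1

/-! ### Integral ideals of `ℤ[√d]`: Hermite normal form -/

/-- **Hermite normal form of an ideal of `ℤ[√d]`** (`d < 0`; Cox, Exercise 7.8: a nonzero ideal
is a free `ℤ`-module of rank 2): `J = k · (n, m + √d)` with `k ≠ 0`, `n > 0`, `n ∣ m² - d`, where
`k` generates the imaginary parts of `J` and `kn` generates `J ∩ ℤ`.
[cite: Cox2013, §7.A Exercise 7.8] -/
theorem exists_eq_span_mul_span (hd0 : d < 0) {J : Ideal (ℤ√d)} (hJ : J ≠ ⊥) :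
    ∃ k n m : ℤ, k ≠ 0 ∧ 0 < n ∧ n ∣ m ^ 2 - d ∧
      J = Ideal.span {(k : ℤ√d)} * Ideal.span {(n : ℤ√d), ⟨m, 1⟩} := by
  -- the ideal of imaginary parts of elements of `J`
  let K : Ideal ℤ :=
    { carrier := {v | ∃ z ∈ J, z.im = v}
      add_mem' := by
        rintro _ _ ⟨z, hz, rfl⟩ ⟨w, hw, rfl⟩
        exact ⟨z + w, J.add_mem hz hw, Zsqrtd.im_add _ _⟩
      zero_mem' := ⟨0, J.zero_mem, rfl⟩
      smul_mem' := by
        rintro c _ ⟨z, hz, rfl⟩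
        exact ⟨(c : ℤ√d) * z, J.mul_mem_left _ hz, by simp⟩ }
  have hKmem : ∀ z ∈ J, z.im ∈ K := fun z hz => ⟨z, hz, rfl⟩
  haveI hKp : K.IsPrincipal := IsPrincipalIdealRing.principal K
  have F1 : ∀ z ∈ J, Submodule.IsPrincipal.generator K ∣ z.im := fun z hz =>
    (Submodule.IsPrincipal.mem_iff_generator_dvd K).1 (hKmem z hz)
  have F2 : ∃ z ∈ J, z.im = Submodule.IsPrincipal.generator K :=
    Submodule.IsPrincipal.generator_mem K
  -- the ideal `J ∩ ℤ`
  let L : Ideal ℤ := J.comap (Int.castRingHom (ℤ√d))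
  haveI hLp : L.IsPrincipal := IsPrincipalIdealRing.principal L
  have F3 : ∀ t : ℤ, (t : ℤ√d) ∈ J → Submodule.IsPrincipal.generator L ∣ t := fun t ht =>
    (Submodule.IsPrincipal.mem_iff_generator_dvd L).1 (Ideal.mem_comap.2 (by simpa using ht))
  have F4 : ((Submodule.IsPrincipal.generator L : ℤ) : ℤ√d) ∈ J := by
    simpa using (Ideal.mem_comap.1 (Submodule.IsPrincipal.generator_mem L))
  -- nonnegative generators
  set k : ℤ := ((Submodule.IsPrincipal.generator K).natAbs : ℤ) with hk
  set n : ℤ := ((Submodule.IsPrincipal.generator L).natAbs : ℤ) with hn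
  have F1' : ∀ z ∈ J, k ∣ z.im := fun z hz => Int.natAbs_dvd.2 (F1 z hz)
  have F2' : ∃ z ∈ J, z.im = k := by
    obtain ⟨z, hz, hzim⟩ := F2
    rcases Int.natAbs_eq (Submodule.IsPrincipal.generator K) with h | h
    · exact ⟨z, hz, by rw [hzim, hk]; exact h⟩
    · exact ⟨-z, J.neg_mem hz, by rw [Zsqrtd.im_neg, hzim, hk]; omega⟩
  have F3' : ∀ t : ℤ, (t : ℤ√d) ∈ J → n ∣ t := fun t ht => Int.natAbs_dvd.2 (F3 t ht)
  have F4' : ((n : ℤ) : ℤ√d) ∈ J := by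
    rcases Int.natAbs_eq (Submodule.IsPrincipal.generator L) with h | h
    · rw [hn, ← h]; exact F4
    · have e : (n : ℤ) = -Submodule.IsPrincipal.generator L := by omega
      rw [e, Int.cast_neg]; exact J.neg_mem F4
  -- both generators are nonzero (`d < 0`: `N(z) = z z̄ ∈ J ∩ ℤ` is nonzero for `z ≠ 0`)
  obtain ⟨z, hzJ, hz0⟩ := Submodule.exists_mem_ne_zero_of_ne_bot hJ
  have hn0 : n ≠ 0 := by
    intro h0
    have h1 : ((z.norm : ℤ) : ℤ√d) ∈ J := by
      rw [Zsqrtd.norm_eq_mul_conj]; exact J.mul_mem_right _ hzJ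
    have h2 := F3' _ h1
    rw [h0, zero_dvd_iff, Zsqrtd.norm_eq_zero_iff hd0] at h2
    exact hz0 h2
  have hnpos : 0 < n := lt_of_le_of_ne (by positivity) (Ne.symm hn0)
  have hk0 : k ≠ 0 := by
    intro h0
    have h1 := F1' z hzJ
    have h2 := F1' _ (J.mul_mem_left Zsqrtd.sqrtd hzJ)
    rw [h0, zero_dvd_iff] at h1 h2
    simp only [Zsqrtd.im_mul, Zsqrtd.re_sqrtd, Zsqrtd.im_sqrtd, zero_mul, one_mul,
      zero_add] at h2
    exact hz0 (Zsqrtd.ext h2 h1)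
  have hkpos : 0 < k := lt_of_le_of_ne (by positivity) (Ne.symm hk0)
  obtain ⟨z₁, hz₁, hz₁im⟩ := F2'
  -- `k ∣ n` and `k ∣ Re z₁` (imaginary parts of `√d·n`, `√d·z₁ ∈ J`)
  have hkn : k ∣ n := by
    have := F1' _ (J.mul_mem_left Zsqrtd.sqrtd F4')
    simpa [Zsqrtd.im_mul] using this
  have hkm : k ∣ z₁.re := by
    have := F1' _ (J.mul_mem_left Zsqrtd.sqrtd hz₁)
    simpa [Zsqrtd.im_mul] using this
  obtain ⟨n', hn'⟩ := hkn
  obtain ⟨m', hm'⟩ := hkm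
  have hn'pos : 0 < n' := by
    by_contra hle
    push Not at hle
    nlinarith
  refine ⟨k, n', m', hk0, hn'pos, ?_, ?_⟩
  · -- `n' ∣ m'² - d`: `(√d - m') z₁ = k (d - m'²) ∈ J ∩ ℤ`
    have h1 : (((k * (d - m' ^ 2)) : ℤ) : ℤ√d) ∈ J := by
      have e : (((k * (d - m' ^ 2)) : ℤ) : ℤ√d) = Zsqrtd.sqrtd * z₁ - (m' : ℤ√d) * z₁ := by
        ext
        · simp only [Zsqrtd.re_intCast, Zsqrtd.re_sub, Zsqrtd.re_mul, Zsqrtd.re_sqrtd,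
            Zsqrtd.im_sqrtd, Zsqrtd.im_intCast, hz₁im, hm']
          ring
        · simp only [Zsqrtd.im_intCast, Zsqrtd.im_sub, Zsqrtd.im_mul, Zsqrtd.re_sqrtd,
            Zsqrtd.im_sqrtd, Zsqrtd.re_intCast, hz₁im, hm']
          ring
      rw [e]
      exact J.sub_mem (J.mul_mem_left _ hz₁) (J.mul_mem_left _ hz₁)
    have h2 := F3' _ h1
    rw [hn'] at h2
    exact dvd_sub_comm.1 ((mul_dvd_mul_iff_left hk0).1 h2)
  · refine (Ideal.eq_span_singleton_mul _ _).2 ⟨fun zI hzI => ?_, fun w hw => ?_⟩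
    · obtain ⟨v, hv⟩ := F1' zI hzI
      have ht : zI - (v : ℤ√d) * z₁ ∈ J := J.sub_mem hzI (J.mul_mem_left _ hz₁)
      have ht' : ((((zI - (v : ℤ√d) * z₁).re) : ℤ) : ℤ√d) ∈ J := by
        convert ht using 1
        ext
        · simp
        · simp only [Zsqrtd.im_intCast, Zsqrtd.im_sub, Zsqrtd.im_mul, Zsqrtd.re_intCast, hv,
            hz₁im]
          ring
      obtain ⟨u, hu⟩ := F3' _ ht'
      refine ⟨(u : ℤ√d) * n' + (v : ℤ√d) * ⟨m', 1⟩, Ideal.mem_span_pair.2 ⟨u, v, rfl⟩, ?_⟩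
      simp only [Zsqrtd.re_sub, Zsqrtd.re_mul, Zsqrtd.re_intCast, Zsqrtd.im_intCast, hm',
        hz₁im] at hu
      rw [hn'] at hu
      ext
      · simp only [Zsqrtd.re_mul, Zsqrtd.re_intCast, Zsqrtd.im_intCast, Zsqrtd.re_add,
          Zsqrtd.im_add, Zsqrtd.im_mul]
        linear_combination -hu
      · simp only [Zsqrtd.im_mul, Zsqrtd.re_intCast, Zsqrtd.im_intCast, Zsqrtd.re_add,
          Zsqrtd.im_add, Zsqrtd.re_mul, hv]
        ring
    · obtain ⟨u, w, rfl⟩ := Ideal.mem_span_pair.1 hw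
      have e : (k : ℤ√d) * (u * n' + w * ⟨m', 1⟩) = u * (n : ℤ√d) + w * z₁ := by
        have e1 : (n : ℤ√d) = k * n' := by rw [hn', Int.cast_mul]
        have e2 : z₁ = (k : ℤ√d) * ⟨m', 1⟩ := by
          ext
          · simp [hm']
          · simp [hz₁im]
        rw [e1, e2]
        ring
      rw [e]
      exact J.add_mem (J.mul_mem_left _ F4') (J.mul_mem_left _ hz₁)

/-- If `I` is an invertible fractional ideal, `A·I ≤ B·I` implies `A ≤ B`. [folklore] -/
theorem le_of_mul_le_mul_of_isUnit {I A B : FractionalIdeal (ℤ√d)⁰ (FractionRing (ℤ√d))}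
    (hI : IsUnit I) (h : A * I ≤ B * I) : A ≤ B := by
  obtain ⟨u, rfl⟩ := hI
  have h2 := mul_le_mul_left h (↑u⁻¹ : FractionalIdeal (ℤ√d)⁰ (FractionRing (ℤ√d)))
  simpa only [mul_assoc, Units.mul_inv, mul_one] using h2

/-- **Cox, Lemma 7.5 with Prop. 7.4 (`⟹`) for `ℤ[√d]`**: if `(n, m + √d)` (`m² - d = nc`) is
invertible then the form `(n, -2m, c)` is primitive.  For `e = gcd(n, 2m, c)` the element
`x = (m + √d)/e` satisfies `x·(n, m + √d) ⊆ (n, m + √d)` (Lemma 7.5's computation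
`βτ = -cn/a + (-bn/a + m)τ`), and an invertible ideal admits only multipliers in `ℤ[√d]`
(Prop. 7.4: `x𝒪 = x𝔞𝔟 ⊆ 𝔞𝔟 = 𝒪`), so `e ∣ 1`. [cite: Cox2013, §7.A Lemma 7.5, Prop. 7.4] -/
theorem isPrimitive_of_isUnit {n m c : ℤ} (hc : m ^ 2 - d = n * c)
    (hu : IsUnit ((Ideal.span {(n : ℤ√d), ⟨m, 1⟩} : Ideal (ℤ√d)) :
      FractionalIdeal (ℤ√d)⁰ (FractionRing (ℤ√d)))) :
    (⟨n, 2 * -m, c⟩ : BinQF).IsPrimitive := by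
  have hraw : (Ideal.span {(n : ℤ√d), ⟨m, 1⟩} : Ideal (ℤ√d)) =
      Ideal.span {(n : ℤ√d), ⟨-(-m), 1⟩} := by rw [neg_neg]
  have hd : (-m) ^ 2 - n * c = d := by linear_combination hc
  show Nat.gcd (Nat.gcd n.natAbs (2 * -m).natAbs) c.natAbs = 1
  set e : ℕ := Nat.gcd (Nat.gcd n.natAbs (2 * -m).natAbs) c.natAbs with he
  have hen : (e : ℤ) ∣ n :=
    Int.ofNat_dvd_left.2 ((Nat.gcd_dvd_left _ _).trans (Nat.gcd_dvd_left _ _))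
  have hem : (e : ℤ) ∣ 2 * -m :=
    Int.ofNat_dvd_left.2 ((Nat.gcd_dvd_left _ _).trans (Nat.gcd_dvd_right _ _))
  have hec : (e : ℤ) ∣ c := Int.ofNat_dvd_left.2 (Nat.gcd_dvd_right _ _)
  obtain ⟨n₁, hn₁⟩ := hen
  obtain ⟨t, ht⟩ := hem
  obtain ⟨c₁, hc₁⟩ := hec
  -- Lemma 7.5: `(m + √d) · (n, m + √d) ⊆ e · (n, m + √d)`
  have hle : Ideal.span {(⟨m, 1⟩ : ℤ√d)} * Ideal.span {(n : ℤ√d), ⟨m, 1⟩} ≤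
      Ideal.span {((e : ℤ) : ℤ√d)} * Ideal.span {(n : ℤ√d), ⟨m, 1⟩} := by
    rw [Ideal.span_singleton_mul_le_span_singleton_mul]
    intro zI hzI
    rw [hraw, mem_span_pair_iff hd] at hzI
    obtain ⟨u, hu'⟩ := hzI
    refine ⟨⟨(u * n₁ - t * zI.im) * m - zI.im * c₁ * n, u * n₁ - t * zI.im⟩, ?_, ?_⟩
    · rw [hraw, mem_span_pair_iff hd]
      exact ⟨-(zI.im * c₁), by dsimp only; ring⟩
    · ext
      · simp only [Zsqrtd.re_mul, Zsqrtd.re_intCast, Zsqrtd.im_intCast]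
        linear_combination m * hu' + (u * m) * hn₁ + (-(zI.im * m)) * ht +
          (-(zI.im * n)) * hc₁ + (-zI.im) * hd
      · simp only [Zsqrtd.im_mul, Zsqrtd.re_intCast, Zsqrtd.im_intCast]
        linear_combination hu' + u * hn₁ + (-zI.im) * ht
  -- Prop. 7.4: multipliers of an invertible ideal lie in `ℤ[√d]`
  have hle' := (FractionalIdeal.coeIdeal_le_coeIdeal (FractionRing (ℤ√d))).2 hle
  rw [FractionalIdeal.coeIdeal_mul, FractionalIdeal.coeIdeal_mul,
    FractionalIdeal.coeIdeal_span_singleton, FractionalIdeal.coeIdeal_span_singleton] at hle'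
  have h2 := le_of_mul_le_mul_of_isUnit hu hle'
  rw [FractionalIdeal.spanSingleton_le_iff_mem, FractionalIdeal.mem_spanSingleton] at h2
  obtain ⟨z, hz⟩ := h2
  rw [Algebra.smul_def, ← map_mul] at hz
  have hz' := IsFractionRing.injective (ℤ√d) (FractionRing (ℤ√d)) hz
  have him := congrArg Zsqrtd.im hz'
  simp only [Zsqrtd.im_mul, Zsqrtd.re_intCast, Zsqrtd.im_intCast, mul_zero, zero_add] at him
  have he1 : (e : ℤ) = 1 := Int.eq_one_of_mul_eq_one_left (by positivity) him
  exact_mod_cast he1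

/-! ### The class group: Cox, Thm. 7.7 (i), (ii) -/

section ClassGroup

variable [IsDomain (ℤ√d)]

/-- **Cox, Thm. 7.7(i) for `ℤ[√d]`**: the ideal of a primitive positive definite form of
discriminant `4d` is invertible, since `𝔞_f · 𝔞_{(a,-b,c)} = (a)` (Cox (7.6)).
[cite: Cox2013, §7.B Thm. 7.7(i)] -/
theorem isUnit_fracIdeal_of_isPosPrim {f : BinQF} (hf : f.IsPosPrim (4 * d)) :
    IsUnit (fracIdeal d f) := by
  obtain ⟨β, hb, hd⟩ := exists_b_eq_two_mul hf.disc_eq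
  obtain ⟨x, y, z, hxyz⟩ := exists_combination_of_isPrimitive hf.primitive
  have hprod := span_pair_mul_span_pair_neg hd ⟨x, y, z, by rw [← hxyz, hb]⟩
  have ha : (algebraMap (ℤ√d) (FractionRing (ℤ√d)) (f.a : ℤ√d)) ≠ 0 := by
    rw [Ne, IsFractionRing.to_map_eq_zero_iff, Int.cast_eq_zero]
    exact hf.a_pos.ne'
  have key : fracIdeal d f *
      ((Ideal.span {(f.a : ℤ√d), ⟨-(-β), 1⟩} : Ideal (ℤ√d)) :
        FractionalIdeal (ℤ√d)⁰ (FractionRing (ℤ√d))) =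
      FractionalIdeal.spanSingleton (ℤ√d)⁰ (algebraMap (ℤ√d) (FractionRing (ℤ√d)) (f.a : ℤ√d)) := by
    rw [fracIdeal, ideal_eq_span_pair hb, ← FractionalIdeal.coeIdeal_mul, hprod,
      FractionalIdeal.coeIdeal_span_singleton]
  have hu : IsUnit (fracIdeal d f *
      ((Ideal.span {(f.a : ℤ√d), ⟨-(-β), 1⟩} : Ideal (ℤ√d)) :
        FractionalIdeal (ℤ√d)⁰ (FractionRing (ℤ√d)))) := by
    rw [key]
    exact IsUnit.of_mul_eq_one _ (FractionalIdeal.spanSingleton_mul_inv (FractionRing (ℤ√d)) ha)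
  exact isUnit_of_mul_isUnit_left hu

/-- Equality of classes of forms with invertible ideals is the relation
`(x) · 𝔞_f = (y) · 𝔞_g`, `x, y ≠ 0` (Mathlib's `ClassGroup.mk_eq_mk_of_coe_ideal`). [folklore] -/
theorem toClass_eq_toClass_iff {f g : BinQF} (hf : IsUnit (fracIdeal d f))
    (hg : IsUnit (fracIdeal d g)) :
    toClass d f = toClass d g ↔
      ∃ x y : ℤ√d, x ≠ 0 ∧ y ≠ 0 ∧ Ideal.span {x} * ideal d f = Ideal.span {y} * ideal d g := by
  rw [toClass_of_isUnit hf, toClass_of_isUnit hg]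
  exact ClassGroup.mk_eq_mk_of_coe_ideal hf.unit_spec hg.unit_spec

/-- **Cox, Thm. 7.7(ii), well-definedness for `ℤ[√d]`**: properly equivalent primitive positive
definite forms of discriminant `4d` have the same ideal class. [cite: Cox2013, §7.B Thm. 7.7(ii)] -/
theorem toClass_eq_of_properEquiv (hd0 : d < 0) {f g : BinQF} (hf : f.IsPosPrim (4 * d))
    (hfg : f.ProperEquiv g) : toClass d f = toClass d g := by
  have hg : g.IsPosPrim (4 * d) := hfg.isPosPrim (by omega) hf
  obtain ⟨p, q, r, s, hdet, rfl⟩ := hfg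
  obtain ⟨β, hb, hd⟩ := exists_b_eq_two_mul hf.disc_eq
  rw [toClass_eq_toClass_iff (isUnit_fracIdeal_of_isPosPrim hf)
    (isUnit_fracIdeal_of_isPosPrim hg)]
  refine ⟨⟨f.a * p + β * r, r⟩, f.a, ?_, by exact_mod_cast hf.a_pos.ne',
    span_mul_ideal_act hb hd hdet⟩
  intro h
  have hr : r = 0 := by simpa using congrArg Zsqrtd.im h
  have hre : f.a * p + β * r = 0 := by simpa using congrArg Zsqrtd.re h
  rw [hr, mul_zero, add_zero] at hre
  rcases mul_eq_zero.1 hre with h0 | h0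
  · exact hf.a_pos.ne' h0
  · rw [h0, hr] at hdet
    simp at hdet

/-- **Cox, Thm. 7.7(ii), surjectivity for `ℤ[√d]`**: every ideal class of `ℤ[√d]` (`d < 0`) is the
class of a reduced primitive positive definite form of discriminant `4d`.  A class is represented
by an invertible integral ideal `J` (clearing denominators); `J = k·(n, m + √d)` (Hermite normal
form, Exercise 7.8), `(n, m + √d) = 𝔞_f` for `f = (n, -2m, (m² - d)/n)`, primitive by Lemma 7.5
and Prop. 7.4, and `f` reduces to a label (Thm. 2.8) in the same class.
[cite: Cox2013, §7.B Thm. 7.7(ii)] -/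
theorem exists_isLabel_toClass_eq_of_neg (hd0 : d < 0) (C : ClassGroup (ℤ√d)) :
    ∃ f : BinQF, IsLabel d f ∧ toClass d f = C := by
  refine ClassGroup.induction (FractionRing (ℤ√d)) (fun I => ?_) C
  obtain ⟨a0, J, ha0, hIJ⟩ :=
    FractionalIdeal.exists_eq_spanSingleton_mul (I : FractionalIdeal (ℤ√d)⁰ (FractionRing (ℤ√d)))
  have ha0' : algebraMap (ℤ√d) (FractionRing (ℤ√d)) a0 ≠ 0 :=
    mt IsFractionRing.to_map_eq_zero_iff.mp ha0
  have hJI : (J : FractionalIdeal (ℤ√d)⁰ (FractionRing (ℤ√d))) =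
      FractionalIdeal.spanSingleton _ (algebraMap _ _ a0) *
        (I : FractionalIdeal (ℤ√d)⁰ (FractionRing (ℤ√d))) := by
    rw [hIJ, ← mul_assoc, FractionalIdeal.spanSingleton_mul_spanSingleton, mul_inv_cancel₀ ha0',
      FractionalIdeal.spanSingleton_one, one_mul]
  have hJunit : IsUnit (J : FractionalIdeal (ℤ√d)⁰ (FractionRing (ℤ√d))) := by
    rw [hJI]
    exact (IsUnit.of_mul_eq_one _
      (FractionalIdeal.spanSingleton_mul_inv (FractionRing (ℤ√d)) ha0')).mul I.isUnit
  have hJ0 : J ≠ ⊥ := by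
    rintro rfl
    rw [FractionalIdeal.coeIdeal_bot] at hJunit
    exact not_isUnit_zero hJunit
  obtain ⟨k, n, m, hk0, hn, hdvd, hJeq⟩ := exists_eq_span_mul_span hd0 hJ0
  obtain ⟨c, hc⟩ := hdvd
  have hk' : algebraMap (ℤ√d) (FractionRing (ℤ√d)) (k : ℤ√d) ≠ 0 := by
    rw [Ne, IsFractionRing.to_map_eq_zero_iff, Int.cast_eq_zero]
    exact hk0
  -- the form `f = (n, -2m, c)` with `𝔞_f = (n, m + √d)`
  set f : BinQF := ⟨n, 2 * -m, c⟩ with hf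
  have hfI : ideal d f = Ideal.span {(n : ℤ√d), ⟨m, 1⟩} := by
    rw [ideal_eq_span_pair (β := -m) rfl, neg_neg]
  have hdisc : f.disc = 4 * d := by
    simp only [disc, hf]
    linear_combination (4 : ℤ) * hc
  have hI'unit : IsUnit ((Ideal.span {(n : ℤ√d), ⟨m, 1⟩} : Ideal (ℤ√d)) :
      FractionalIdeal (ℤ√d)⁰ (FractionRing (ℤ√d))) := by
    have e : ((Ideal.span {(n : ℤ√d), ⟨m, 1⟩} : Ideal (ℤ√d)) :
        FractionalIdeal (ℤ√d)⁰ (FractionRing (ℤ√d))) =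
        FractionalIdeal.spanSingleton _ (algebraMap _ _ (k : ℤ√d))⁻¹ *
          (J : FractionalIdeal (ℤ√d)⁰ (FractionRing (ℤ√d))) := by
      rw [hJeq, FractionalIdeal.coeIdeal_mul, FractionalIdeal.coeIdeal_span_singleton, ← mul_assoc,
        FractionalIdeal.spanSingleton_mul_spanSingleton, inv_mul_cancel₀ hk',
        FractionalIdeal.spanSingleton_one, one_mul]
    rw [e]
    refine IsUnit.mul ?_ hJunit
    exact IsUnit.of_mul_eq_one _
      (FractionalIdeal.spanSingleton_mul_inv (FractionRing (ℤ√d)) (inv_ne_zero hk'))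
  have hfp : f.IsPosPrim (4 * d) := ⟨hdisc, hn, isPrimitive_of_isUnit hc hI'unit⟩
  obtain ⟨g, hfg, hgr⟩ := exists_properEquiv_isReduced (by omega : 4 * d < 0) hfp
  refine ⟨g, ⟨hfg.isPosPrim (by omega) hfp, hgr⟩, ?_⟩
  rw [← toClass_eq_of_properEquiv hd0 hfp hfg,
    toClass_of_isUnit (isUnit_fracIdeal_of_isPosPrim hfp)]
  -- `[𝔞_f] = [J] = [I]`
  have hmkJ : ClassGroup.mk (FractionRing (ℤ√d)) I =
      ClassGroup.mk (FractionRing (ℤ√d)) hJunit.unit := by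
    rw [ClassGroup.mk_eq_mk]
    refine ⟨Units.mk0 _ ha0', Units.ext ?_⟩
    rw [Units.val_mul, coe_toPrincipalIdeal, Units.val_mk0, IsUnit.unit_spec, hJI, mul_comm]
  rw [hmkJ, ClassGroup.mk_eq_mk_of_coe_ideal (isUnit_fracIdeal_of_isPosPrim hfp).unit_spec
    hJunit.unit_spec]
  refine ⟨k, 1, by exact_mod_cast hk0, one_ne_zero, ?_⟩
  rw [hfI, ← hJeq, Ideal.span_singleton_one, Ideal.top_mul]

end ClassGroup

/-- **Cox, Thm. 7.7 (i)–(ii) with Thm. 2.8, for the order `ℤ[√d]` of discriminant `4d < 0`**: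
the named fact `cox_formClassGroup` holds — the ideal `[a, (-b + √D)/2]` of a primitive positive
definite form of discriminant `D = 4d` is invertible (`isUnit_fracIdeal_of_isPosPrim`), properly
equivalent forms have the same class (`toClass_eq_of_properEquiv`), and `f ↦ [𝔞_f]` is a bijection
from reduced forms onto `C(ℤ[√d])` (injective by `properEquiv_of_span_mul_ideal_eq` and the
uniqueness of reduced forms, Thm. 2.8; surjective by `exists_isLabel_toClass_eq_of_neg`).
[cite: Cox2013, §7.B Thm. 7.7 (i)–(ii) with §2.A Thm. 2.8 and §7.A Prop. 7.4] -/
theorem cox_formClassGroup_holds : cox_formClassGroup := by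
  intro d _ hd0
  refine ⟨fun f hf => isUnit_fracIdeal_of_isPosPrim hf,
    fun f g hf hfg => toClass_eq_of_properEquiv hd0 hf hfg, ?_, ?_⟩
  · rintro ⟨f, hf⟩ ⟨g, hg⟩ hfg
    obtain ⟨x, y, hx, hy, h⟩ := (toClass_eq_toClass_iff (isUnit_fracIdeal_of_isPosPrim hf.1)
      (isUnit_fracIdeal_of_isPosPrim hg.1)).1 hfg
    exact Subtype.ext (eq_of_properEquiv_of_isReduced hf.1 hg.1 hf.2 hg.2
      (properEquiv_of_span_mul_ideal_eq hd0 hf.1 hg.1 hx hy h))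
  · intro C
    obtain ⟨f, hf, hfC⟩ := exists_isLabel_toClass_eq_of_neg hd0 C
    exact ⟨⟨f, hf⟩, hfC⟩

end Literature.NumberTheory.QuadraticFields.Quadratic.BinQF
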